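import Mathlib
import Literature.Analysis.FluidPDE.AxisymmetricVorticityTransport
import Literature.Analysis.FluidPDE.VorticityCalculus
import Summits.NavierStokesRegularity.NavierStokesRegularity.Theses.MirrorChamber
import HarnessLib

/-!
# `MirrorChamber.MirrorVorticityLaw` — the mirror law for a reflection-equivariant classical
  solution (item stmt-NavierStokesRegularity-1601)

**Statement.** `(u, p)` classical on `ℝ³ × [0, T)` (any `ν`, unforced), equivariant at every
`t ∈ [0, T)` under the reflection `R_k : x_k ↦ −x_k`, `u(t, R_k x) = R_k u(t, x)`. Then at interior
times `t ∈ (0, T)` and mirror points `x_k = 0`: (i) the tangential vorticity vanishes, `ω_i = 0` for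
`i ≠ k`; (ii) `∂ₜω_k + u·∇ω_k − ω_k ∂_k u_k = ν Δω_k`.

PROOF (a computation, as the item says).
(i) Differentiating `u(t) ∘ R_k = R_k ∘ u(t)` at a mirror point gives `Du(t,x) ∘ R_k = R_k ∘ Du(t,x)`;
reading off entries, `∂_j u_k = 0` (`j ≠ k`) and `∂_k u_l = 0` (`l ≠ k`), hence every component
`ω_i`, `i ≠ k`, of the curl (a difference `∂_j u_l − ∂_l u_j` with `k ∈ {j, l}`, `i ∉ {j, l}`)
vanishes. (ii) The `k`-th component of the tree's pointwise vorticity equation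
(`IsClassicalNSSolutionOn.isVorticitySolutionOn_Ico`: `∂ₜω + (u·∇)ω = (ω·∇)u + νΔω`), with
`(ω·∇)u_k = ω_k ∂_k u_k` by (i); the one-sided time derivative within `[0, T)` is the two-sided one
at interior times.

HONEST FRAMING: elementary symmetry bookkeeping for HYPOTHETICAL reflection-equivariant solutions;
nothing here bears on the regularity problem itself.
-/

noncomputable section

set_option linter.dupNamespace false

namespace Summit.NavierStokesRegularity.NavierStokesRegularity.Theorems

open MeasureTheory Set Filter Topology Function Literature.Analysis.FluidPDE
open scoped NNReal ENNReal

namespace MirrorLaw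

/-- **Entries of the gradient of a reflection-equivariant field at a mirror point**: if
`v (R_k y) = R_k (v y)` for the coordinate reflection `R_k : x_k ↦ −x_k` and `x_k = 0`, then
`∂_j v_k (x) = 0` for `j ≠ k` and `∂_k v_l (x) = 0` for `l ≠ k` (differentiate `v ∘ R_k = R_k ∘ v`:
`Dv(x) ∘ R_k = R_k ∘ Dv(x)`). [folklore] -/
theorem fderiv_entries_of_mirror {v : EuclideanSpace ℝ (Fin 3) → EuclideanSpace ℝ (Fin 3)}
    {k : Fin 3} (hv : Differentiable ℝ v)
    (hsym : ∀ y : EuclideanSpace ℝ (Fin 3), v (WithLp.toLp 2 fun i => if i = k then -y i else y i) =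
      WithLp.toLp 2 fun i => if i = k then -(v y i) else v y i)
    {x : EuclideanSpace ℝ (Fin 3)} (hx : x k = 0) :
    (∀ j, j ≠ k → fderiv ℝ v x (EuclideanSpace.single j 1) k = 0) ∧
      (∀ l, l ≠ k → fderiv ℝ v x (EuclideanSpace.single k 1) l = 0) := by
  -- the reflection as a continuous linear map (a local term, no definition is introduced)
  let RL : EuclideanSpace ℝ (Fin 3) →L[ℝ] EuclideanSpace ℝ (Fin 3) :=
    LinearMap.toContinuousLinearMap
      { toFun := fun y => WithLp.toLp 2 fun i => if i = k then -y i else y i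
        map_add' := fun y z => by
          ext i
          simp only [PiLp.add_apply]
          split_ifs <;> ring
        map_smul' := fun c y => by
          ext i
          simp only [PiLp.smul_apply, smul_eq_mul, RingHom.id_apply]
          split_ifs <;> ring }
  have hRL : ∀ (y : EuclideanSpace ℝ (Fin 3)) (i : Fin 3),
      RL y i = if i = k then -y i else y i := fun _ _ => rfl
  have hsym' : ∀ y, v (RL y) = RL (v y) := hsym
  -- `Dv(x) ∘ R = R ∘ Dv(x)` at the mirror point
  have hxR : RL x = x := by
    ext i
    rw [hRL]
    split_ifs with h
    · rw [h, hx, neg_zero]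
    · rfl
  have h1 : HasFDerivAt (v ∘ RL) ((fderiv ℝ v (RL x)).comp RL) x :=
    (hv (RL x)).hasFDerivAt.comp x RL.hasFDerivAt
  have h2 : HasFDerivAt (fun y => RL (v y)) (RL.comp (fderiv ℝ v x)) x :=
    RL.hasFDerivAt.comp x (hv x).hasFDerivAt
  have hfun : (v ∘ RL) = fun y => RL (v y) := funext hsym'
  rw [hfun, hxR] at h1
  have hcomm : (fderiv ℝ v x).comp RL = RL.comp (fderiv ℝ v x) := h1.unique h2
  have happ : ∀ w, fderiv ℝ v x (RL w) = RL (fderiv ℝ v x w) := fun w => by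
    have := congrArg (fun M : EuclideanSpace ℝ (Fin 3) →L[ℝ] EuclideanSpace ℝ (Fin 3) => M w) hcomm
    simpa only [ContinuousLinearMap.comp_apply] using this
  -- the reflection on basis vectors
  have hRe : ∀ j, RL (EuclideanSpace.single j 1) =
      if j = k then -EuclideanSpace.single j 1 else EuclideanSpace.single j 1 := by
    intro j
    ext i
    rw [hRL]
    by_cases hj : j = k
    · subst hj
      rw [if_pos rfl, PiLp.neg_apply]
      by_cases hi : i = j
      · rw [if_pos hi]
      · rw [if_neg hi]
        simp [hi]
    · rw [if_neg hj]
      by_cases hi : i = k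
      · subst hi
        rw [if_pos rfl]
        simp [Ne.symm hj]
      · rw [if_neg hi]
  constructor
  · intro j hj
    have h := happ (EuclideanSpace.single j 1)
    rw [hRe j, if_neg hj] at h
    -- component `k`: `a = -a`
    have hk := congrArg (fun w : EuclideanSpace ℝ (Fin 3) => w k) h
    simp only [hRL, if_true] at hk
    linarith
  · intro l hl
    have h := happ (EuclideanSpace.single k 1)
    rw [hRe k, if_pos rfl, map_neg] at h
    have hk := congrArg (fun w : EuclideanSpace ℝ (Fin 3) => w l) h
    simp only [PiLp.neg_apply, hRL, hl, if_false] at hk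
    linarith

/-- **The tangential vorticity vanishes on the mirror**: for a differentiable field equivariant
under `R_k : x_k ↦ −x_k` and `x_k = 0`, `(curl v x)_i = 0` for all `i ≠ k`. [folklore] -/
theorem curl_apply_eq_zero_of_mirror {v : EuclideanSpace ℝ (Fin 3) → EuclideanSpace ℝ (Fin 3)}
    {k : Fin 3} (hv : Differentiable ℝ v)
    (hsym : ∀ y : EuclideanSpace ℝ (Fin 3), v (WithLp.toLp 2 fun i => if i = k then -y i else y i) =
      WithLp.toLp 2 fun i => if i = k then -(v y i) else v y i)
    {x : EuclideanSpace ℝ (Fin 3)} (hx : x k = 0) {i : Fin 3} (hi : i ≠ k) : curl v x i = 0 := by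
  obtain ⟨hA, hB⟩ := fderiv_entries_of_mirror hv hsym hx
  fin_cases k <;> simp only [Fin.zero_eta, Fin.mk_one, Fin.reduceFinMk] at hA hB hi ⊢
  · have h1 := hA 1 (by decide)
    have h2 := hA 2 (by decide)
    have h3 := hB 1 (by decide)
    have h4 := hB 2 (by decide)
    fin_cases i
    · exact absurd rfl hi
    · simp [curl, h1, h2, h3, h4]
    · simp [curl, h1, h2, h3, h4]
  · have h1 := hA 0 (by decide)
    have h2 := hA 2 (by decide)
    have h3 := hB 0 (by decide)
    have h4 := hB 2 (by decide)
    fin_cases i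
    · simp [curl, h1, h2, h3, h4]
    · exact absurd rfl hi
    · simp [curl, h1, h2, h3, h4]
  · have h1 := hA 0 (by decide)
    have h2 := hA 1 (by decide)
    have h3 := hB 0 (by decide)
    have h4 := hB 1 (by decide)
    fin_cases i
    · simp [curl, h1, h2, h3, h4]
    · simp [curl, h1, h2, h3, h4]
    · exact absurd rfl hi

/-- A vector of `ℝ³` whose components other than `k` vanish is `v_k e_k`. [folklore] -/
theorem eq_smul_single_of_apply_eq_zero {w : EuclideanSpace ℝ (Fin 3)} {k : Fin 3}
    (h : ∀ i, i ≠ k → w i = 0) : w = w k • EuclideanSpace.single k 1 := by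
  ext i
  by_cases hi : i = k
  · subst hi; simp
  · simp [hi, h i hi]

end MirrorLaw

open MirrorLaw in
/-- **Item stmt-NavierStokesRegularity-1601** (`MirrorChamber.MirrorVorticityLaw`): for a
classical solution equivariant under the reflection `x_k ↦ −x_k`, at interior times and mirror points
the tangential vorticity vanishes and `∂ₜω_k + u·∇ω_k − ω_k ∂_k u_k = ν Δω_k`.
[cite: BealeKatoMajda1984, §1 (vorticity equation)] -/
theorem mirrorChamber_mirrorVorticityLaw_proof :
    Summit.NavierStokesRegularity.NavierStokesRegularity.Theses.MirrorChamber.MirrorVorticityLaw := by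
  unfold Summit.NavierStokesRegularity.NavierStokesRegularity.Theses.MirrorChamber.MirrorVorticityLaw
  intro ν T u p k hsol hsymm t ht x hx
  have htI : t ∈ Ico 0 T := Ioo_subset_Ico_self ht
  have hu : ContDiff ℝ (⊤ : ℕ∞) (u t) := hsol.contDiff_velocity htI
  have hud : Differentiable ℝ (u t) := hu.differentiable (by norm_cast)
  -- (i) tangential vorticity
  have hi : ∀ i, i ≠ k → curl (u t) x i = 0 := fun i hi =>
    curl_apply_eq_zero_of_mirror hud (hsymm t htI) hx hi
  refine ⟨hi, ?_⟩
  -- (ii) the `k`-th component of the vorticity equation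
  have hV := hsol.isVorticitySolutionOn_Ico (fun s _ y => by simp [curl])
  have heq := hV.vorticity_eq t htI x
  -- smoothness of the vorticity
  have hω2 : ContDiff ℝ 2 (curl (u t)) := contDiff_curl (n := 2) (hu.of_le (by norm_cast))
  have hωd : Differentiable ℝ (curl (u t)) := hω2.differentiable (by norm_num)
  have hωst : IsSmoothSpaceTimeOn (Ico 0 T) (vorticity u) :=
    hsol.smooth_velocity.isSmoothSpaceTimeOn_vorticity (uniqueDiffOn_Ico 0 T)
  -- components of the four terms
  have hcoord : ∀ (U : EuclideanSpace ℝ (Fin 3) → EuclideanSpace ℝ (Fin 3)),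
      Differentiable ℝ U → ∀ w : EuclideanSpace ℝ (Fin 3),
        fderiv ℝ U x w k = fderiv ℝ (fun y => U y k) x w := by
    intro U hU w
    have h : (fun y => U y k) = fun y =>
        (EuclideanSpace.proj k : EuclideanSpace ℝ (Fin 3) →L[ℝ] ℝ) (U y) := rfl
    rw [h, fderiv_fun_comp x (EuclideanSpace.proj k :
      EuclideanSpace ℝ (Fin 3) →L[ℝ] ℝ).differentiableAt (hU x), ContinuousLinearMap.fderiv]
    rfl
  have hT : timeDerivWithin (Ico 0 T) (vorticity u) t x k =
      deriv (fun s => curl (u s) x k) t := by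
    rw [← hωst.timeDerivWithin_euclidean_comp (uniqueDiffOn_Ico 0 T) k htI x,
      timeDerivWithin_apply, derivWithin_of_mem_nhds (Ico_mem_nhds ht.1 ht.2)]
    rfl
  have hC1 : convect (u t) (vorticity u t) x k =
      fderiv ℝ (fun y => curl (u t) y k) x (u t x) := by
    rw [convect_apply]
    exact hcoord _ hωd _
  have hC2 : convect (vorticity u t) (u t) x k =
      curl (u t) x k * fderiv ℝ (fun y => u t y k) x (EuclideanSpace.single k 1) := by
    have hω : vorticity u t x = curl (u t) x k • EuclideanSpace.single k 1 :=
      eq_smul_single_of_apply_eq_zero hi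
    rw [convect_apply, hω, map_smul, PiLp.smul_apply, smul_eq_mul, hcoord _ hud]
  have hL : (Laplacian.laplacian (vorticity u t)) x k =
      (Laplacian.laplacian fun y => curl (u t) y k) x := by
    have h : (fun y => curl (u t) y k) =
        (EuclideanSpace.proj k : EuclideanSpace ℝ (Fin 3) →L[ℝ] ℝ) ∘ curl (u t) := rfl
    rw [h, ContDiffAt.laplacian_CLM_comp_left hω2.contDiffAt]
    rfl
  have hk := congrArg (fun w : EuclideanSpace ℝ (Fin 3) => w k) heq
  simp only [PiLp.add_apply, PiLp.smul_apply, smul_eq_mul] at hk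
  rw [hT, hC1, hC2, hL] at hk
  linarith

end Summit.NavierStokesRegularity.NavierStokesRegularity.Theorems

end
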